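import Summits.CriticalPhenomena.PercolationContinuityZ3.Theorems.Transplant.SkelFrmBChoiceResidF
import Summits.CriticalPhenomena.PercolationContinuityZ3.Theorems.Transplant.SkelFrmBParamsKitS
import HarnessLib

/-!
# N2 (frames-only node `SamePDropOfSkeletonFrm₁`, OPEN) — (ζ″) ledger: THE (F)-COLUMN EXCESS RESIDUAL OF THE WRAPPER `NegB.exF2` AND ITS FLOOR LEMMAS
# (hp-8 g44; the second (F) residual file, same style as `SkelFrmBChoiceResidF` / stmt's `SkelFrmBChoiceResidC`)

The (F) wrapper's layer chain `NegB.faceOblRM_frmBVC₀…₆` over the keystone `Skelφ.faceOblRM_of_kits9VC` pins the face kit radius at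
`r := L′(SUS ex mx)` (`Skelφ.Prm.Lp`, N1's choice; `L′ = ex + Rex(2ψπ) + 24·rmax′ + 3ψπ + 48` by `Lp_SUS_eq`), after which EVERY slot-floor row of the
keystone (`hL' hRlr hRb₀ hr₁R hRr₀ hr₂R hRsr hρr hR₁b hR₁r hr₀L hYbr hrX hrY`) is a FLOOR ON THE EXCESS SLOT `ex`.  This file names the floors as ONE slot
function of the p-fixed data and proves the `le_max`-level lemmas:
* **`exF2 mk c : GSlot := max {exFc mk c, KS.Rs mk, KS0.r₀0 mk R_b, KS0.r₀0 mk R_L, KS.YbF c mk}`** with the bridge-frame prism radius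
  `R_b := D.R (D.scale t (MBF c mk) (nBF c mk))` (BridgeF) and p3's long link radius `R_L := RLD D g f` (ResidC; `RL O gv fv = RLD O.merged …` by `rfl`);
  `r₀0 mk X = max base0 (X + reach0)` (ChoiceNums), so `base0`, `reach0`, `R_b`, `R_L` are floors too (`exF2_floors'`);
* transfer to any dominating slot value (the node file's `exQ ⊒ exF2 mk (cF κ)`): **`floors_of_ge2`** (the eight floors at `(D, g, f)`) and **`exFc_le_of_ge2`**
  (so ResidF's `hπX_of_ge/hπY_of_ge` apply through `exF2`);
* §3 (appended, hp-8 g44 after lead g14 J27): the (F) demand on the rim-diameter slot **`mxF mk : GSlot := ⌈m_F⌉₊`** (the node tuple's `mxR := mxF 0`),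
  `mxF_at`, **`mF_le_mxF`**, `mF_le_of_ge`.
CELL-AGNOSTIC; imports ResidF (⟹ ResidC `RLD`, ZPiYA budgets, BridgeFrameF `YbF`, BridgeF `MBF/nBF`), KitS (`KS.Rs`).
NON-VACUITY: a definition + `le_max`-level lemmas.
builds on p205010 (kernel theorem, internal audit signed; external expert review pending) — nothing in this file uses p205010; NOTHING is claimed about the open
node `SamePDropOfSkeletonFrm₁`.
Lane `prim-bschramm`, seat `prim-hp-8` (gen 44); helper file (`--supports stmt-CriticalPhenomena-4575 --as helper`).
[cite: KozmaNitzan2024, §4 Theorem 6 (pp. 25–31): the order of constants] [cite: MartineauTassion2017, §3.2 Lemma 3.5]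
-/

noncomputable section

open scoped Classical


namespace Summit.CriticalPhenomena.PercolationContinuityZ3.Theorems.Transplant

open Literature.Probability.Percolation Literature.Probability.LatticeModels SimpleGraph
open SkelConc (Consts)
open Skelφ.StepI (DataNS OutNS)
open Neg

namespace PlanarSkeletonFrm

namespace NegB

/-! ## §1 The wrapper's (F)-column excess residual -/

/-- **The (F) wrapper's EXCESS residual** `exF2 mk c := max (exFc mk c) (max (Rs mk) (max (r₀0 mk R_b) (max (r₀0 mk R_L) (YbF c mk))))`
(see the module docstring). [this work] -/
def exF2 (mk c : ℕ) : GSlot := fun κ _ _ _ _ _ Φ t p D g f =>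
  max (exFc mk c κ Φ t p D g f) (max (KS.Rs t D mk) (max (KS0.r₀0 t D mk (D.R (D.toDataN.scale t (KS.MBF κ Φ t p D c mk) (KS.nBF κ Φ t p D c mk)))) (max (KS0.r₀0 t D mk (RLD κ Φ t p D g f)) (KS.YbF κ Φ t p D c mk g f))))

section Floors

variable (κ : Consts) {V : Type} [DecidableEq V] [Countable V] {G : SimpleGraph V} [G.LocallyFinite] (Φ : PlanarSkeletonFrm G) (t : V) (p : unitInterval)
  (D : DataNS V) (g f mk c : ℕ)

/-- `exF2` by name. [folklore] -/
theorem exF2_at : exF2 mk c κ Φ t p D g f =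
    max (exFc mk c κ Φ t p D g f) (max (KS.Rs t D mk) (max (KS0.r₀0 t D mk (D.R (D.toDataN.scale t (KS.MBF κ Φ t p D c mk) (KS.nBF κ Φ t p D c mk)))) (max (KS0.r₀0 t D mk (RLD κ Φ t p D g f)) (KS.YbF κ Φ t p D c mk g f)))) := rfl

/-- **The five floors inside `exF2`**: `exFc ≤ exF2`, `Rs ≤ exF2`, `r₀0 R_b ≤ exF2`, `r₀0 R_L ≤ exF2`, `YbF ≤ exF2`. [folklore] -/
theorem exF2_floors : exFc mk c κ Φ t p D g f ≤ exF2 mk c κ Φ t p D g f ∧ KS.Rs t D mk ≤ exF2 mk c κ Φ t p D g f ∧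
    KS0.r₀0 t D mk (D.R (D.toDataN.scale t (KS.MBF κ Φ t p D c mk) (KS.nBF κ Φ t p D c mk))) ≤ exF2 mk c κ Φ t p D g f ∧
      KS0.r₀0 t D mk (RLD κ Φ t p D g f) ≤ exF2 mk c κ Φ t p D g f ∧ KS.YbF κ Φ t p D c mk g f ≤ exF2 mk c κ Φ t p D g f := by
  refine ⟨?_, ?_, ?_, ?_, ?_⟩ <;> rw [exF2_at] <;> omega

/-- **The derived floors**: `base0 ≤ exF2`, `reach0 ≤ exF2`, `R_b + reach0 ≤ exF2`, `R_L + reach0 ≤ exF2`, `πBudX ≤ exF2`, `πBudY ≤ exF2`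
(`r₀0 X = max base0 (X + reach0)`, `exFc = max πBudX πBudY`). [folklore] -/
theorem exF2_floors' : KS0.base0 t D mk ≤ exF2 mk c κ Φ t p D g f ∧ KS0.reach0 t D mk ≤ exF2 mk c κ Φ t p D g f ∧
    (D.R (D.toDataN.scale t (KS.MBF κ Φ t p D c mk) (KS.nBF κ Φ t p D c mk))) + KS0.reach0 t D mk ≤ exF2 mk c κ Φ t p D g f ∧
      (RLD κ Φ t p D g f) + KS0.reach0 t D mk ≤ exF2 mk c κ Φ t p D g f ∧
        KS.πBudX κ Φ t p D c mk g f ≤ exF2 mk c κ Φ t p D g f ∧ KS.πBudY κ Φ t p D c mk g f ≤ exF2 mk c κ Φ t p D g f := by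
  obtain ⟨h1, -, h3, h4, -⟩ := exF2_floors κ Φ t p D g f mk c
  have hb := KS0.r₀0_ge t D mk (D.R (D.toDataN.scale t (KS.MBF κ Φ t p D c mk) (KS.nBF κ Φ t p D c mk)))
  have hl := KS0.r₀0_ge t D mk (RLD κ Φ t p D g f)
  have hc := exFc_floors κ Φ t p D g f mk c
  omega

end Floors

/-! ## §2 Transfer to a dominating slot value -/

section Transfer

variable {κ : Consts} {V : Type} [DecidableEq V] [Countable V] {G : SimpleGraph V} [G.LocallyFinite] {Φ : PlanarSkeletonFrm G} {t : V} {p : unitInterval}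
  {mk c : ℕ}

/-- **`exFc ≤ ex`** from any excess residual dominating `exF2` (so ResidF's `hπX_of_ge/hπY_of_ge` apply). [folklore] -/
theorem exFc_le_of_ge2 {ex : GSlot} (h : ∀ (D : DataNS V) (g f : ℕ), exF2 mk c κ Φ t p D g f ≤ ex κ Φ t p D g f) (D : DataNS V) (g f : ℕ) :
    exFc mk c κ Φ t p D g f ≤ ex κ Φ t p D g f :=
  (exF2_floors κ Φ t p D g f mk c).1.trans (h D g f)

/-- **The slot rows' floors at `(D, g, f)`** from any excess residual dominating `exF2`: `Rs ≤ ex`, `r₀0 R_b ≤ ex`, `r₀0 R_L ≤ ex`, `YbF ≤ ex`,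
`base0 ≤ ex`, `reach0 ≤ ex`, `πBudX ≤ ex`, `πBudY ≤ ex`. [folklore] -/
theorem floors_of_ge2 {ex : GSlot} (h : ∀ (D : DataNS V) (g f : ℕ), exF2 mk c κ Φ t p D g f ≤ ex κ Φ t p D g f) (D : DataNS V) (g f : ℕ) :
    KS.Rs t D mk ≤ ex κ Φ t p D g f ∧ KS0.r₀0 t D mk (D.R (D.toDataN.scale t (KS.MBF κ Φ t p D c mk) (KS.nBF κ Φ t p D c mk))) ≤ ex κ Φ t p D g f ∧
      KS0.r₀0 t D mk (RLD κ Φ t p D g f) ≤ ex κ Φ t p D g f ∧ KS.YbF κ Φ t p D c mk g f ≤ ex κ Φ t p D g f ∧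
        KS0.base0 t D mk ≤ ex κ Φ t p D g f ∧ KS0.reach0 t D mk ≤ ex κ Φ t p D g f ∧
          KS.πBudX κ Φ t p D c mk g f ≤ ex κ Φ t p D g f ∧ KS.πBudY κ Φ t p D c mk g f ≤ ex κ Φ t p D g f := by
  have hx := h D g f
  obtain ⟨-, h2, h3, h4, h5⟩ := exF2_floors κ Φ t p D g f mk c
  obtain ⟨h6, h7, -, -, h8, h9⟩ := exF2_floors' κ Φ t p D g f mk c
  exact ⟨h2.trans hx, h3.trans hx, h4.trans hx, h5.trans hx, h6.trans hx, h7.trans hx, h8.trans hx, h9.trans hx⟩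

end Transfer

/-! ## §3 The (F) demand on the rim-diameter slot: `mxF` (hp-8 g44; the node tuple's `mxR := NegB.mxF 0`, lead g14 J27 / coherence rule) -/

/-- **The (F) column's RIM-DIAMETER demand** `mxF mk : GSlot := ⌈m_F⌉₊` — the face block ceiling `(prFA D g f).mF (fcellsA D g f)` as a natural number
(`Int.toNat`; the wrapper's `hmx : m_F ≤ mx` holds at any `mx ⊒ mxF mk`; the index `mk` is carried for the tuple's uniform shape only). [this work] -/
def mxF (_mk : ℕ) : GSlot := fun κ _ _ _ _ _ Φ t p D g f => ((prFA κ Φ t p D g f).mF (fcellsA κ Φ t p D g f)).toNat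

section MxF

variable (κ : Consts) {V : Type} [DecidableEq V] [Countable V] {G : SimpleGraph V} [G.LocallyFinite] (Φ : PlanarSkeletonFrm G) (t : V) (p : unitInterval)
  (D : DataNS V) (g f mk : ℕ)

/-- `mxF` by name. [folklore] -/
theorem mxF_at : mxF mk κ Φ t p D g f = ((prFA κ Φ t p D g f).mF (fcellsA κ Φ t p D g f)).toNat := rfl

/-- **`hmx` at `mx := mxF mk`**: `m_F ≤ mxF mk` (in `ℤ`). [folklore] -/
theorem mF_le_mxF : (prFA κ Φ t p D g f).mF (fcellsA κ Φ t p D g f) ≤ (((mxF mk κ Φ t p D g f) : ℕ) : ℤ) := by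
  rw [mxF_at]; exact Int.self_le_toNat _

/-- **`hmx` at any `mx ⊒ mxF mk`.** [folklore] -/
theorem mF_le_of_ge {mx : GSlot} (h : ∀ (D : DataNS V) (g f : ℕ), mxF mk κ Φ t p D g f ≤ mx κ Φ t p D g f) :
    (prFA κ Φ t p D g f).mF (fcellsA κ Φ t p D g f) ≤ (((mx κ Φ t p D g f) : ℕ) : ℤ) :=
  (mF_le_mxF κ Φ t p D g f mk).trans (by exact_mod_cast h D g f)

end MxF

end NegB

end PlanarSkeletonFrm

end Summit.CriticalPhenomena.PercolationContinuityZ3.Theorems.Transplant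

end
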